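import Summits.BirchSwinnertonDyer.BirchSwinnertonDyer.Theorems.TeichmullerTwistDescentWeightExclusionOfThreeFacts
import Literature.NumberTheory.GaloisRepresentations.SerreWeightLevelOneLowerBoundProofs
import Literature.NumberTheory.EllipticCurves.FullLevelHomologySerreWeightOfEigenMap
import HarnessLib

/-!
# Route `TeichmullerTwistDescent`: the weight exclusion (W‴) for EVERY additive (G)-ordinary unstarred prime `p ≥ 5` —
# Kummer corner `(p, e) ∈ {(5, 4), (7, 6)}` included — from the three named facts (signed weight, Kraus Prop. 1, Edixhoven 4.5)

Cell `pub/bsd-wall` (D-0145 line route-BirchSwinnertonDyer-TeichmullerTwistDescent, OPEN rev 8), seat `bsd-line-ttd-p1` (prover 1/2,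
g29).  THEOREMS ONLY; `--supports stmt-BirchSwinnertonDyer-24306` (WILD half of the Kummer corner CORNER 23883).  BSD is not proved
by this file; no item is closed by it; the corner items 24306 / 24307 / 23883 are NOT proved by it.

WHAT.  The K-line (g24–g28) proved the Serre-weight exclusion (W‴) `NoEtaleWeightEigenQuotient` — «no nonzero `GL₂(𝔽_p)`-equivariant
Hecke-eigen (for `W`) map `Θ : H₁(Γ₀(M), ℤ_p[GL₂(𝔽_p)]) → Sym^{2b}(𝔽_p²) ⊗ (ω^{−b}∘det)`, `b = tameExponent p W`» — under the K
prefix `11 ≤ p` from three named facts, type by type (II, III, IV), through the GENERIC evaluation of Serre's recipe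
(`serreWeight_eq_of_hasLevelOneInertiaShape_generic`, which needs `|α − β| ≠ 1`, i.e. `b ≥ 2`, i.e. `p ≥ 11`).  The route pen's
key for this seat (EVENT88, README-TTD-Kline) asks whether the lever transfers to the Kummer corner `(p, ord_pΔ) ∈ {(5, 3), (7, 2)}`,
where `e = p − 1` and `b = 1`.  It does, uniformly: with the SIGNED weight statement the twist `ω^s ρ̄_W` (`s ≡ b`) has the
level-one shape `(β, α) = (1, 2b)` on ALL three Kodaira types (`shape_signed`), and the new Literature LOWER BOUND
`le_serreWeight_of_hasLevelOneInertiaShape` (adjacent exponents allowed) gives `k(ω^s ρ̄_W) ≥ 1 + p + 2b > p ≥ 2b + 2 = w`,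
against Edixhoven's `k ≤ w`.  Hence:

* `false_of_twist_isModular_of_shape_le` — the contradiction step for ANY normalised shape with `1 ≤ α, β ≤ p − 2` (no genericity);
* `eq_zero_of_eigenMap_of_five_le` — **(W‴)₅: the text of `NoEtaleWeightEigenQuotient` with `11 ≤ p` replaced by `5 ≤ p`** (so the
  corner `b = 1` and the cell `(7, IV)` (`b = 2`) are covered), from `fullLevelHomology_twist_isModular_of_eigenMap_signed` ∧
  `Kraus1997.propOne_inertiaShape_of_ordinary` ∧ `edixhoven1992_serreWeight_le_weight_of_newform`;
  (at `11 ≤ p` it re-proves the K-line's `KOfNamedInputs.noEtaleWeightEigenQuotient_of_named_facts` by one uniform argument);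
* `tameExponent_eq_one_of_corner`, `eq_zero_of_eigenMap_of_corner` — the corner reading: at `(5, III)` / `(7, II)` the tame exponent is
  `1` and no equivariant Hecke-eigen `Θ` onto `Sym² ⊗ (ω^{−1}∘det)` exists (the JH constituent `Sym² ⊗ det^{p−2}` of the reduction of
  the corner type `PS(ω̃^{p−2}, ω̃)` is weight-killed — the pen's first-hour question, answered YES in the kernel).

WHAT THIS DOES NOT GIVE (the typed obstruction of the transfer, seat memo KLINE-CORNER-ttdp1g29.md): the K-line's remaining steps
(type ⟹ functional ⟹ saturation) are stated under `11 ≤ p` but use only `5 ≤ p` (mechanical twins), whereas the LAST step of the GE11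
glue — `p ∤ c̃` for the optimal curve of the `p*`-twisted (starred) class by Edixhoven 1991 Thm. 3 — is typed `7 < p`
(`edixhoven_not_dvd_maninConstant_of_kodairaSymbol_ne`): at `p = 7` the partner `(7, IV*)` (`e = 3`) is inside Edixhoven's method but
outside his printed range, at `p = 5` the partner `(5, III*)` (`e = 4 = p − 1`) is outside both.  So the five-print argument does not
close the corner; it reduces CORNER F″-free to the Manin unit of the STARRED partner.
-/

set_option autoImplicit false
-- single-conjunct summit: `Summit.BirchSwinnertonDyer.BirchSwinnertonDyer.…` repeats the name by design
set_option linter.dupNamespace false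

noncomputable section

open scoped MatrixGroups NumberField Valued
open Function CongruenceSubgroup IsDedekindDomain ValuativeRel
open Literature.RepresentationTheory.FiniteGroups Literature.RepresentationTheory.FiniteGroups.GL2
  Literature.NumberTheory.EllipticCurves.ModularForms
open Literature.NumberTheory.EllipticCurves (Kato2004.teichmullerChar)
open Literature.NumberTheory.ModularSymbols Literature.NumberTheory.ModularSymbols.FullLevel
open Literature.NumberTheory.GaloisRepresentations Literature.NumberTheory.GaloisRepresentations.ModPGaloisRep
open Literature.NumberTheory.GaloisRepresentations.IsNonarchimedeanLocalField
open Literature.NumberTheory.Automorphic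

namespace Summit.BirchSwinnertonDyer.BirchSwinnertonDyer.Theorems.TeichmullerTwistDescent

open WeierstrassCurve Literature.NumberTheory.EllipticCurves Literature.NumberTheory.EllipticCurves.Rank1Residual
open Summit.BirchSwinnertonDyer.BirchSwinnertonDyer.Theses.TeichmullerTwistDescent

namespace WeightExclusionFive

/-! ### Arithmetic of the signed shape (all three Kodaira types at once) -/

/-- With `2b ≤ p − 1`, `2 ≤ p` and the SIGNED congruence `p − 1 ∣ s + (p − 1 − b)` (i.e. `s ≡ b`), the exponents `(p − b + s, b + s)` of
the twist `ω^s ⊗ (ω^{1−b} ∗; 0 ω^b)` are `≡ (1, 2b)` mod `p − 1` — uniformly in the Kodaira type. [folklore] -/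
theorem shape_signed {p b s : ℕ} (hp : 2 ≤ p) (hb2 : 2 * b ≤ p - 1) (hs : (p - 1) ∣ s + (p - 1 - b)) :
    p - b + s ≡ 1 [MOD p - 1] ∧ b + s ≡ 2 * b [MOD p - 1] := by
  obtain ⟨m, hm⟩ := hs
  have hsr : s + (p - 1 - b) ≡ 0 [MOD p - 1] := by
    unfold Nat.ModEq
    rw [hm, Nat.mul_mod_right, Nat.zero_mod]
  refine ⟨?_, ?_⟩
  · rw [show p - b + s = s + (p - 1 - b) + 1 by omega]
    exact hsr.add_right 1
  · refine Nat.ModEq.add_right_cancel' (p - 1 - 2 * b) ?_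
    rw [show b + s + (p - 1 - 2 * b) = s + (p - 1 - b) by omega, show 2 * b + (p - 1 - 2 * b) = 0 + (p - 1) by omega]
    exact hsr.trans Nat.add_modEq_right.symm

/-! ### The contradiction from ANY normalised level-one shape with `1 ≤ α, β ≤ p − 2` -/

/-- **Generic-or-adjacent step.**  As `WeightExclusion.false_of_twist_isModular_of_generic_shape`, WITHOUT the genericity hypotheses
`β ≠ α + 1`, `α ≠ β + 1`: if the shape `(a + s, a' + s)` of the twist `ω^s ρ̄ ⊗ k` is congruent mod `p − 1` to `(β, α)` with
`1 ≤ α, β ≤ p − 2`, then `k(ω^s ρ̄) ≥ 1 + p·min(α, β) + max(α, β) ≥ p + 2` (`le_serreWeight_of_hasLevelOneInertiaShape`, the très ramifiée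
correction only adds `p − 1`) contradicts Edixhoven's `k(ω^s ρ̄) ≤ w ≤ p` for a modular `ω^s ρ̄` of weight `w` and level prime to `p`.
[cite: Edixhoven1992, Thm. 4.5] [cite: Serre1987, §2.3 (2.3.2), §2.4 (i), (ii₁), (ii₂)] -/
theorem false_of_twist_isModular_of_shape_le {p : ℕ} [Fact p.Prime] {k : Type} [Field k] [TopologicalSpace k]
    [DiscreteTopology k] [CharP k p] [IsAlgClosed k] (hp2 : p ≠ 2)
    (hEd : edixhoven1992_serreWeight_le_weight_of_newform)
    {ρ : ModPGaloisRep ℚ (ZMod p) 2}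
    (hdet : ∀ σ : Field.absoluteGaloisGroup ℚ, Matrix.GeneralLinearGroup.det (ρ σ) = modPCyclotomicCharacterZMod ℚ p σ)
    (habs : FramedRep.IsAbsolutelyIrreducible ρ) (j : ZMod p →+* k) {a a' : ℕ}
    (hKr : ∀ (loc : LocalRestrictionAt p (FramedRep.baseChange j continuous_of_discreteTopology ρ))
      (ι : absIntegers 𝒪[loc.F] loc.F ⧸ absMaximalIdeal loc.F →+* k),
      loc.rep.HasLevelOneInertiaShape ι ((p : ℕ) : 𝒪[loc.F]) loc.irreducible_natCast a a')
    {s β α : ℕ} (hβ : a + s ≡ β [MOD p - 1]) (hα : a' + s ≡ α [MOD p - 1])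
    (hα1 : 1 ≤ α) (hαp : α + 2 ≤ p) (hβ1 : 1 ≤ β) (hβp : β + 2 ≤ p)
    {N : ℕ} [NeZero N] (hpN : ¬ p ∣ N) {w : ℤ} (hw2 : 2 ≤ w) (hwp : w ≤ p)
    (f : CuspForm (Gamma1 N) w) (ιf : coeffCharIntegers f →+* k) (hf : IsNewform1 f)
    (hgal : IsGaloisRepOfNewform1Int f ιf {q | q ∣ N * p}
      (FramedRep.twist (FramedRep.baseChange j continuous_of_discreteTopology ρ) (modPCyclotomicCharacter ℚ k p j ^ s))) :
    False := by
  have hp : p.Prime := Fact.out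
  -- irreducibility and oddness of the twist
  have hirrbc : (FramedRep.baseChange j continuous_of_discreteTopology ρ).toContinuousRep.IsIrreducible :=
    habs.isIrreducible_baseChange k j _
  have hirr' : (FramedGaloisRep.toGaloisRep (K := ℚ)
      (FramedRep.twist (FramedRep.baseChange j continuous_of_discreteTopology ρ) (modPCyclotomicCharacter ℚ k p j ^ s) :
        ModPGaloisRep ℚ k 2)).IsIrreducible := by
    refine FramedRep.isIrreducible_of_twist (χ := modPCyclotomicCharacter ℚ k p j ^ s) (fun g => ?_) hirrbc
    rw [FramedRep.twist_apply]
    congr 1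
  have hodd : FramedGaloisRep.IsOdd (FramedRep.baseChange j continuous_of_discreteTopology ρ) :=
    (ModPGaloisRep.isOdd_of_det_eq_modPCyclotomicCharacterZMod ρ hdet).baseChange j _
  have hodd' : FramedGaloisRep.IsOdd
      (FramedRep.twist (FramedRep.baseChange j continuous_of_discreteTopology ρ) (modPCyclotomicCharacter ℚ k p j ^ s)) := by
    intro φ c hc
    rw [FramedRep.det_twist_apply, ← map_pow, hc.sq_eq_one, map_one, one_mul]
    exact hodd φ c hc
  -- local restriction datum, residue embedding, twisted datum
  obtain ⟨loc₀⟩ := nonempty_localRestrictionAt p (FramedRep.baseChange j continuous_of_discreteTopology ρ)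
  obtain ⟨ι⟩ := nonempty_ringHom_residue (k := k) p loc₀.F loc₀.residueFieldCard_eq
  let loc' : LocalRestrictionAt p
      (FramedRep.twist (FramedRep.baseChange j continuous_of_discreteTopology ρ) (modPCyclotomicCharacter ℚ k p j ^ s) :
        ModPGaloisRep ℚ k 2) :=
    { F := loc₀.F
      residueFieldCard_eq := loc₀.residueFieldCard_eq
      irreducible_natCast := loc₀.irreducible_natCast
      rep := FramedRep.twist loc₀.rep ((modPCyclotomicCharacter ℚ k p j ^ s).comp (absGaloisRestrict ℚ loc₀.F))
      rep_eq_restrictField := by rw [loc₀.rep_eq_restrictField, WeightExclusion.restrictField_twist] }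
  -- Edixhoven: `k(ω^s ρ̄) ≤ w`
  have hdet' : ∃ σ ∈ absInertia loc'.F, Matrix.GeneralLinearGroup.det (loc'.rep σ) ≠ 1 :=
    WeightExclusion.exists_det_twist_ne_one hp2 hdet j loc₀ s
  have hle := hEd p (hp.odd_of_ne_two hp2) k _ hirr' hodd' N hpN w hw2 f ιf hf hgal loc' ι hdet'
  -- the shape of the twist, normalised, and the LOWER BOUND of Serre's recipe (adjacent exponents allowed)
  have hsh := WeightExclusion.hasLevelOneInertiaShape_twist_pow loc₀ ι j (hKr loc₀ ι) s
  have hq : residueFieldCard loc₀.F - 1 = p - 1 := by rw [loc₀.residueFieldCard_eq]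
  have hsh' : loc'.rep.HasLevelOneInertiaShape ι ((p : ℕ) : 𝒪[loc'.F]) loc'.irreducible_natCast β α :=
    hsh.of_modEq (by rw [hq]; exact hβ) (by rw [hq]; exact hα)
  have hge := le_serreWeight_of_hasLevelOneInertiaShape loc' ι hsh' hα1 hαp hβ1 hβp
  have hge' : p + 2 ≤ serreWeight p _ loc' ι := by
    have h1 : 1 ≤ min α β := le_min hα1 hβ1
    have h2 : 1 ≤ max α β := le_trans hα1 (le_max_left α β)
    have : p ≤ p * min α β := Nat.le_mul_of_pos_right p (by omega)
    omega
  omega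

/-! ### (W‴)₅: the weight exclusion for every `p ≥ 5` (Kummer corner and `(7, IV)` included) -/

/-- **(W‴)₅ — `NoEtaleWeightEigenQuotient` with `11 ≤ p` replaced by `5 ≤ p`, from the three named facts.**  For `W/ℚ` elliptic,
globally minimal, of conductor `p²M`, `5 ≤ p`, additive and (G)-ordinary at `p` with `ord_pΔ_min ≤ 4` (Kodaira II / III / IV; at `p = 5`
this is III with `b = 1`, at `p = 7` it is II with `b = 1` or IV with `b = 2`) and `E[p]` irreducible: every `ℤ_p`-linear
`GL₂(𝔽_p)`-equivariant Hecke-eigen (for `W`) map `Θ : H₁(Γ₀(M), ℤ_p[GL₂(𝔽_p)]) → Sym^{2b}(𝔽_p²) ⊗ (ω^{−b}∘det)`, `b = tameExponent p W`,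
is ZERO.  Proof: a nonzero `Θ` makes `ω^s ρ̄_W` modular of weight `2b + 2 ≤ p`, level prime to `p`, with `s ≡ b` (SIGNED weight fact);
Kraus: `ρ̄_W|I_p ∼ (ω^{1−b} ∗; 0 ω^b)`, so the twist has shape `(1, 2b)` (`shape_signed`); Serre's recipe gives `k ≥ p + 2`
(`false_of_twist_isModular_of_shape_le`), Edixhoven `k ≤ 2b + 2 ≤ p`.
[cite: BuzzardDiamondJarvis2010, §2 Prop. 2.5, Cor. 2.10 (2)] [cite: AshStevens1986, Thm. 3.5 (a)] [cite: Kraus1997Dissertationes, Prop. 1]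
[cite: Edixhoven1992, Thm. 4.5] [cite: Serre1987, §2.3–2.4] -/
theorem eq_zero_of_eigenMap_of_five_le
    (hWt : fullLevelHomology_twist_isModular_of_eigenMap_signed)
    (hKr : Kraus1997.propOne_inertiaShape_of_ordinary)
    (hEd : edixhoven1992_serreWeight_le_weight_of_newform)
    (p M : ℕ) [Fact p.Prime] [NeZero M] (W : WeierstrassCurve ℚ) [W.IsElliptic] [W.IsGloballyMinimal]
    (hN : W.conductorNorm ℤ = p ^ 2 * M) (hp5 : 5 ≤ p) (hadd : Rank1Residual.Addv W p) (hirr : Rank1Residual.Irr W p)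
    (hGo : Summit.BirchSwinnertonDyer.Rank1Residual.Additive.TypeGOrd W p) (hV4 : padicValInt p W.minimalDiscriminantInt ≤ 4) :
    letI : Algebra ℤ_[p] (ZMod p) := (PadicInt.toZMod (p := p)).toAlgebra
    ∀ Θ : H1carrier ℤ_[p] p M →ₗ[ℤ_[p]] ↥(MvPolynomial.homogeneousSubmodule (Fin 2) (ZMod p) (2 * tameExponent p W)),
    (∀ (g : GL (Fin 2) (ZMod p)) (z : H1carrier ℤ_[p] p M),
        Θ (H1carrierRep ℤ_[p] p M g z) =
          symPowTwist (ZMod.castHom (dvd_refl p) (ZMod p))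
            (reduceChar (ZMod p) (Kato2004.teichmullerChar p ^ (p - 1 - tameExponent p W)))
            (2 * tameExponent p W) g (Θ z)) →
    (∀ (q : ℕ) [NeZero q] (hq : q.Prime) (hqp : q ≠ p) (z : H1carrier ℤ_[p] p M),
        Θ (heckeT ℤ_[p] p M hq hqp z) = (((W.LFunction q : ℤ) : ZMod p)) • Θ z) →
    Θ = 0 := by
  intro Θ hΘG hΘT
  by_contra hΘ0
  have hp : p.Prime := Fact.out
  have hp2 : p ≠ 2 := by omega
  have hb1 : 0 < tameExponent p W := TameExponent.tameExponent_pos W p hp5 hadd hGo hV4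
  have hb2 : 2 * tameExponent p W < p - 1 := TameExponent.two_mul_tameExponent_lt W p hp5 hadd hGo hV4
  have hpM : Nat.Coprime p M := WeightExclusion.coprime_of_conductorNorm_eq_sq_mul W p M hp5 hN
  haveI : NeZero ((p : ℕ) : ℚ) := ⟨by exact_mod_cast hp.ne_zero⟩
  obtain ⟨ρ, hρ⟩ := W.exists_isTorsionGaloisRep p
  letI : TopologicalSpace (AlgebraicClosure (ZMod p)) := ⊥
  haveI : DiscreteTopology (AlgebraicClosure (ZMod p)) := ⟨rfl⟩
  obtain ⟨s, N, hN0, f, ιf, hsdiv, hpN, hf, hgal⟩ :=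
    hWt p M W (2 * tameExponent p W) (p - 1 - tameExponent p W) hp5 hpM (by omega) ⟨2, by omega⟩ hirr
      ⟨Θ, hΘ0, hΘG, hΘT⟩ ρ hρ (AlgebraicClosure (ZMod p)) (algebraMap (ZMod p) (AlgebraicClosure (ZMod p)))
  haveI := hN0
  have hPGO : W.HasPotentiallyGoodOrdinaryReductionAtPrime p :=
    W.hasPotentiallyGoodOrdinaryReductionAtPrime_of_forall_intermediateField p hp hGo
  have hKr' : ∀ (loc : LocalRestrictionAt p (FramedRep.baseChange (algebraMap (ZMod p) (AlgebraicClosure (ZMod p)))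
      continuous_of_discreteTopology ρ)) (ι : absIntegers 𝒪[loc.F] loc.F ⧸ absMaximalIdeal loc.F →+* AlgebraicClosure (ZMod p)),
      loc.rep.HasLevelOneInertiaShape ι ((p : ℕ) : 𝒪[loc.F]) loc.irreducible_natCast (p - tameExponent p W) (tameExponent p W) :=
    fun loc ι => hKr p hp5 W hadd hPGO ρ hρ (AlgebraicClosure (ZMod p)) _ continuous_of_discreteTopology loc ι
  obtain ⟨hβ, hα⟩ := shape_signed (p := p) (b := tameExponent p W) (by omega) (by omega) hsdiv
  exact false_of_twist_isModular_of_shape_le hp2 hEd (W.det_eq_modPCyclotomicCharacter_of_isTorsionGaloisRep_holds p ρ hρ)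
    (BCDT.isAbsolutelyIrreducible_of_hasIrreducibleModPGaloisRep W hp2 hirr hρ) _ hKr' hβ hα
    (by omega) (by omega) le_rfl (by omega) hpN (w := ((2 * tameExponent p W : ℕ) : ℤ) + 2)
    (by omega) (by push_cast; omega) f ιf hf hgal

/-! ### The Kummer corner reading -/

/-- At the Kummer corner `(p, ord_pΔ_min) ∈ {(5, 3), (7, 2)}` the tame exponent `(p − 1)·ord_pΔ_min/12` is `1` (`e = p − 1`). [folklore] -/
theorem tameExponent_eq_one_of_corner (p : ℕ) (W : WeierstrassCurve ℚ) [W.IsGloballyMinimal]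
    (hcell : (p = 5 ∧ padicValInt p W.minimalDiscriminantInt = 3) ∨ (p = 7 ∧ padicValInt p W.minimalDiscriminantInt = 2)) :
    tameExponent p W = 1 := by
  unfold tameExponent
  rcases hcell with ⟨rfl, h⟩ | ⟨rfl, h⟩ <;> rw [h]

/-- **The weight lever at the Kummer corner.**  On CORNER's own binders (`KummerCornerTorsionOptimalManinUnit`: `W` minimal, III at `5`
or II at `7`, additive, `E[p]` irreducible, (G)-ordinary — the `ℚ_p`-rational `p`-torsion point and the datum are not needed), granted the
three named facts: every `GL₂(𝔽_p)`-equivariant Hecke-eigen `Θ` from the full-level carrier to `Sym^{2b} ⊗ (ω^{−b}∘det)`, `b = tameExponent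
p W` (`= 1` here, `tameExponent_eq_one_of_corner`: the target is `Sym²(𝔽_p²) ⊗ (ω^{−1}∘det)`, the JH constituent `Sym² ⊗ det^{p−2}` of
the reduction of the corner type `PS(ω̃^{p−2}, ω̃)`), is zero.  The corner items are NOT closed by this (see the module docstring for the
obstruction at the last glue step). [cite: Kraus1997Dissertationes, Prop. 1] [cite: Edixhoven1992, Thm. 4.5]
[cite: BuzzardDiamondJarvis2010, §2 Prop. 2.5, Cor. 2.10 (2)] -/
theorem eq_zero_of_eigenMap_of_corner
    (hWt : fullLevelHomology_twist_isModular_of_eigenMap_signed)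
    (hKr : Kraus1997.propOne_inertiaShape_of_ordinary)
    (hEd : edixhoven1992_serreWeight_le_weight_of_newform)
    (p M : ℕ) [Fact p.Prime] [NeZero M] (W : WeierstrassCurve ℚ) [W.IsElliptic] [W.IsGloballyMinimal]
    (hN : W.conductorNorm ℤ = p ^ 2 * M)
    (hcell : (p = 5 ∧ padicValInt p W.minimalDiscriminantInt = 3) ∨ (p = 7 ∧ padicValInt p W.minimalDiscriminantInt = 2))
    (hadd : Rank1Residual.Addv W p) (hirr : Rank1Residual.Irr W p)
    (hGo : Summit.BirchSwinnertonDyer.Rank1Residual.Additive.TypeGOrd W p) :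
    letI : Algebra ℤ_[p] (ZMod p) := (PadicInt.toZMod (p := p)).toAlgebra
    ∀ Θ : H1carrier ℤ_[p] p M →ₗ[ℤ_[p]] ↥(MvPolynomial.homogeneousSubmodule (Fin 2) (ZMod p) (2 * tameExponent p W)),
    (∀ (g : GL (Fin 2) (ZMod p)) (z : H1carrier ℤ_[p] p M),
        Θ (H1carrierRep ℤ_[p] p M g z) =
          symPowTwist (ZMod.castHom (dvd_refl p) (ZMod p))
            (reduceChar (ZMod p) (Kato2004.teichmullerChar p ^ (p - 1 - tameExponent p W)))
            (2 * tameExponent p W) g (Θ z)) →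
    (∀ (q : ℕ) [NeZero q] (hq : q.Prime) (hqp : q ≠ p) (z : H1carrier ℤ_[p] p M),
        Θ (heckeT ℤ_[p] p M hq hqp z) = (((W.LFunction q : ℤ) : ZMod p)) • Θ z) →
    Θ = 0 := by
  have hp5 : 5 ≤ p := by rcases hcell with ⟨rfl, -⟩ | ⟨rfl, -⟩ <;> norm_num
  have hV4 : padicValInt p W.minimalDiscriminantInt ≤ 4 := by rcases hcell with ⟨-, h⟩ | ⟨-, h⟩ <;> omega
  exact eq_zero_of_eigenMap_of_five_le hWt hKr hEd p M W hN hp5 hadd hirr hGo hV4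

end WeightExclusionFive

end Summit.BirchSwinnertonDyer.BirchSwinnertonDyer.Theorems.TeichmullerTwistDescent
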